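import Mathlib
import Literature.MathematicalPhysics.StatisticalMechanics.MiePotential
import Literature.MathematicalPhysics.StatisticalMechanics.BarlowStacking
import Literature.MathematicalPhysics.StatisticalMechanics.HcpHomogeneous
import Literature.MathematicalPhysics.StatisticalMechanics.PeriodicConfigurationSums
import Literature.MathematicalPhysics.StatisticalMechanics.LennardJonesClusters
import Summits.AtomisticToContinuum.Crystallization.Theorems.ExcessDecayLiouvilleFarField
import Summits.AtomisticToContinuum.Crystallization.Theorems.ChargedEnergyGap.Negative.BlocksBound
import Summits.AtomisticToContinuum.Crystallization.Theorems.OneCentreSteepnessLadderZeroDensityOfDefectsBookkeeping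
import HarnessLib

/-!
# Route `OneCentreSteepnessLadder`, item `ZeroDensityOfDefects` (stmt-AtomisticToContinuum-12886), II:
# blocks of the hexagonal close packing as trial states for the Mie `(2q, q)` energy

Helper file (supports `ZeroDensityOfDefects`): the energy of a finite block of
`hcpStacking a h` (`a, h > 0`, `q ≥ 4`), measured against the one-centre value
`Φ_hcp = Σ'_{p ∈ hcpStacking a h} φ_q(‖p‖)`, `φ_q(r) = 2r⁻ᵠ − r⁻²ᵠ = −2q·V_q(r)`.

* Generic block identity for a periodic configuration `Q` and a potential `W` with `W 0 = 0` and
  summable punctured site sums: `2·𝓔_W(block_K) = Σ_u siteSum_W(u) − Σ_u tail_W(u)`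
  (`two_mul_energy_block_eq_of_summable`; the Lennard-Jones case is
  `ChargedEnergyGapNegative.Blocks.two_mul_energy_block_eq`).
* HCP is homogeneous (`hcpStacking_homogeneous`): every punctured site sum equals the one at the
  origin (`hcp_siteSum_eq`), and the latter is the `tsum` over `hcpStacking a h` once the (zero)
  self-term is added (`tsum_ne_zero_eq_tsum_hcp`).
* Tails (any `m`-separated periodic configuration): `V_q ≥ −r⁻ᵠ/q`, and the inverse-power sums
  outside the block are `≤ 1024/(m³ m^{q−3})` always and `≤ 1024/(m³ R^{q−3})` at
  `depth Q R`-deep block points (`ExcessDecayLiouville.tsum_inv_pow_le_of_separated`,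
  `Blocks.le_dist_of_deep`); HCP is `min a h`-separated.
* **`four_q_energy_block_le`**: `4q·𝓔_{V_q}(block_K) ≤ −n_K Φ_hcp + 2 n_K·1024/(m³R^{q−3})
  + 12·#F·depth(R)·K²·1024/(m³m^{q−3})`, `n_K = #F·K³` the number of block points.

All `[folklore]`; nothing here closes an item.
-/

noncomputable section

namespace Summit.AtomisticToContinuum.Crystallization.Theorems.OneCentreSteepnessLadderZeroDensity

open scoped BigOperators
open Literature.MathematicalPhysics.StatisticalMechanics
open Summit.AtomisticToContinuum.Crystallization.Theorems.ExcessDecayLiouville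
  (sum_inv_pow_le_of_separated summable_inv_pow_of_separated tsum_inv_pow_le_of_separated)
open Summit.AtomisticToContinuum.Crystallization.Theorems.ChargedEnergyGapNegative.Blocks
  (BIdx bpt bpt_mem bpt_injective blockConfig blockConfig_apply blockConfig_injective card_BIdx
    IsDeep card_not_deep_le siteSum blockOthers tail sum_blockOthers depth le_dist_of_deep)

/-! ## Generic block identity -/

section Generic

variable (Q : PeriodicConfiguration 3)

/-- Splitting a summable punctured site sum at a block point into the block part and the tail.
[folklore] -/
theorem siteSum_eq_sum_add_tail_of_summable (W : ℝ → ℝ) (K : ℕ) (u : BIdx Q K)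
    (hW : Summable fun y : {y // y ∈ Q.points ∧ y ≠ bpt Q K u} => W (dist (bpt Q K u) y.1)) :
    siteSum Q W (bpt Q K u) =
      ∑ v ∈ Finset.univ.erase u, W (dist (bpt Q K u) (bpt Q K v)) + tail Q K W u := by
  unfold siteSum tail
  rw [← sum_blockOthers, hW.sum_add_tsum_compl]

/-- Twice the block energy is the full double sum over block indices (`W 0 = 0`). [folklore] -/
theorem two_mul_energy_blockConfig_eq_sum_sum (W : ℝ → ℝ) (hW0 : W 0 = 0) (K : ℕ) :
    2 * interactionEnergy W (blockConfig Q K) =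
      ∑ u : BIdx Q K, ∑ v : BIdx Q K, W (dist (bpt Q K u) (bpt Q K v)) := by
  rw [two_mul_interactionEnergy_eq_sum_sum W hW0]
  simp only [blockConfig_apply]
  exact ((Fintype.equivFin (BIdx Q K)).symm.sum_comp (fun p => ∑ b,
    W (dist (bpt Q K p) (bpt Q K ((Fintype.equivFin (BIdx Q K)).symm b))))).trans
    (Finset.sum_congr rfl fun p _ => (Fintype.equivFin (BIdx Q K)).symm.sum_comp
      (fun v => W (dist (bpt Q K p) (bpt Q K v))))

/-- **Block energy identity** for a potential with `W 0 = 0` and summable punctured site sums: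
`2·𝓔_W(block_K) = Σ_u siteSum_W(bpt u) − Σ_u tail_W(u)`. [folklore] -/
theorem two_mul_energy_block_eq_of_summable (W : ℝ → ℝ) (hW0 : W 0 = 0) (K : ℕ)
    (hW : ∀ x : EuclideanSpace ℝ (Fin 3),
      Summable fun y : {y // y ∈ Q.points ∧ y ≠ x} => W (dist x y.1)) :
    2 * interactionEnergy W (blockConfig Q K) =
      ∑ u : BIdx Q K, siteSum Q W (bpt Q K u) - ∑ u : BIdx Q K, tail Q K W u := by
  rw [two_mul_energy_blockConfig_eq_sum_sum Q W hW0, ← Finset.sum_sub_distrib]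
  refine Finset.sum_congr rfl fun u _ => ?_
  rw [siteSum_eq_sum_add_tail_of_summable Q W K u (hW _),
    ← Finset.add_sum_erase _ _ (Finset.mem_univ u), dist_self, hW0]
  ring

/-- The Mie punctured site sums of a periodic configuration of `ℝ³` are summable (`q ≥ 4 > 3`).
[folklore] -/
theorem summable_miePotential_dist {q : ℕ} (hq : 4 ≤ q) (x : EuclideanSpace ℝ (Fin 3)) :
    Summable fun y : {y // y ∈ Q.points ∧ y ≠ x} => miePotential q (dist x y.1) := by
  have h1 := Q.summable_inv_pow_dist (show 3 < 2 * q by omega) x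
  have h2 := Q.summable_inv_pow_dist (show 3 < q by omega) x
  exact ((h1.mul_left (1 / (2 * (q : ℝ)))).sub (h2.mul_left (1 / (q : ℝ)))).congr
    fun y => by rw [miePotential_apply]

end Generic

/-! ## The hexagonal close packing: separation, homogeneity, site sums -/

section Hcp

variable {a h : ℝ}

/-- HCP with spacings `a, h > 0` is `min a h`-separated (as a statement about the point set of
`hcpPeriodicConfiguration`). [folklore] -/
theorem hcpConfig_separated (ha : 0 < a) (hh : 0 < h) :
    ∀ x ∈ (hcpPeriodicConfiguration ha.ne' hh.ne').points,
      ∀ y ∈ (hcpPeriodicConfiguration ha.ne' hh.ne').points, x ≠ y → min a h ≤ dist x y := by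
  intro x hx y hy hxy
  rw [hcpPeriodicConfiguration_points] at hx hy
  exact le_dist_of_mem_barlowStacking a h alternatingHagg ha.le hh.le hx hy hxy

/-- **Homogeneity of punctured site sums**: at every point `x` of HCP, `Σ'_{y ≠ x} f(|x − y|)`
equals the punctured sum at the origin `Σ'_{p ≠ 0} f(‖p‖)` (transport along the linear isometry
`B` of `hcpStacking_homogeneous`, `y = x + B p`). [folklore] -/
theorem hcp_siteSum_eq (ha : a ≠ 0) (hh : h ≠ 0) (f : ℝ → ℝ) {x : EuclideanSpace ℝ (Fin 3)}
    (hx : x ∈ (hcpPeriodicConfiguration ha hh).points) :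
    ∑' y : {y // y ∈ (hcpPeriodicConfiguration ha hh).points ∧ y ≠ x}, f (dist x y.1) =
      ∑' p : {p // p ∈ (hcpPeriodicConfiguration ha hh).points ∧ p ≠ 0}, f ‖p.1‖ := by
  obtain ⟨B, hB⟩ := hcpPeriodicConfiguration_homogeneous a h ha hh hx
  set P := (hcpPeriodicConfiguration ha hh).points with hP
  have hto : ∀ p : {p // p ∈ P ∧ p ≠ 0}, x + B p.1 ∈ P ∧ x + B p.1 ≠ x := fun p =>
    ⟨(hB p.1).1 p.2.1, fun h0 => p.2.2 (B.injective (by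
      rw [LinearIsometryEquiv.map_zero]; simpa using h0))⟩
  have hinv : ∀ y : {y // y ∈ P ∧ y ≠ x}, B.symm (y.1 - x) ∈ P ∧ B.symm (y.1 - x) ≠ 0 := fun y =>
    ⟨(hB _).2 (by simpa using y.2.1), fun h0 => y.2.2 (sub_eq_zero.1 (B.symm.injective (by
      rw [h0, LinearIsometryEquiv.map_zero])))⟩
  let e : {p // p ∈ P ∧ p ≠ 0} ≃ {y // y ∈ P ∧ y ≠ x} :=
    { toFun := fun p => ⟨x + B p.1, hto p⟩
      invFun := fun y => ⟨B.symm (y.1 - x), hinv y⟩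
      left_inv := fun p => Subtype.ext (by simp)
      right_inv := fun y => Subtype.ext (by simp) }
  rw [← e.tsum_eq]
  refine tsum_congr fun p => ?_
  show f (dist x (x + B p.1)) = f ‖p.1‖
  rw [dist_self_add_right, LinearIsometryEquiv.norm_map]

/-- Adding the self-term: for `f 0 = 0`, the punctured origin sum over HCP is the full `tsum` over
`hcpStacking a h`. [folklore] -/
theorem tsum_ne_zero_eq_tsum_hcp (ha : a ≠ 0) (hh : h ≠ 0) (f : ℝ → ℝ) (hf : f 0 = 0) :
    ∑' p : {p // p ∈ (hcpPeriodicConfiguration ha hh).points ∧ p ≠ 0}, f ‖p.1‖ =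
      ∑' p : ↥(hcpStacking a h), f ‖(p : EuclideanSpace ℝ (Fin 3))‖ := by
  classical
  rw [hcpPeriodicConfiguration_points]
  have h1 : ∑' p : {p // p ∈ hcpStacking a h ∧ p ≠ 0}, f ‖p.1‖ =
      ∑' p : EuclideanSpace ℝ (Fin 3), {p | p ∈ hcpStacking a h ∧ p ≠ 0}.indicator
        (fun p => f ‖p‖) p :=
    tsum_subtype {p | p ∈ hcpStacking a h ∧ p ≠ 0} (fun p => f ‖p‖)
  have h2 : ∑' p : ↥(hcpStacking a h), f ‖(p : EuclideanSpace ℝ (Fin 3))‖ =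
      ∑' p : EuclideanSpace ℝ (Fin 3), (hcpStacking a h).indicator (fun p => f ‖p‖) p :=
    tsum_subtype (hcpStacking a h) (fun p => f ‖p‖)
  rw [h1, h2]
  refine tsum_congr fun p => ?_
  by_cases hp : p = 0
  · subst hp
    simp only [Set.indicator_apply, Set.mem_setOf_eq, ne_eq, not_true_eq_false, and_false,
      norm_zero, hf, ite_self]
  · simp only [Set.indicator_apply, Set.mem_setOf_eq, ne_eq, hp, not_false_eq_true, and_true]

/-- **The HCP one-centre value**: at every point `x` of HCP the punctured Mie site sum equals
`−Φ_hcp/(2q)`, `Φ_hcp = Σ'_{p ∈ hcpStacking a h} φ_q(‖p‖)`. [folklore] -/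
theorem hcp_siteSum_miePotential_eq (ha : a ≠ 0) (hh : h ≠ 0) {q : ℕ} (hq : q ≠ 0)
    {x : EuclideanSpace ℝ (Fin 3)} (hx : x ∈ (hcpPeriodicConfiguration ha hh).points) :
    siteSum (hcpPeriodicConfiguration ha hh) (miePotential q) x =
      -(1 / (2 * (q : ℝ))) * ∑' p : ↥(hcpStacking a h),
        (2 * (‖(p : EuclideanSpace ℝ (Fin 3))‖)⁻¹ ^ q -
          (‖(p : EuclideanSpace ℝ (Fin 3))‖)⁻¹ ^ (2 * q)) := by
  unfold siteSum
  rw [hcp_siteSum_eq ha hh (miePotential q) hx,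
    tsum_ne_zero_eq_tsum_hcp ha hh (miePotential q) (miePotential_zero hq), ← tsum_mul_left]
  exact tsum_congr fun p => miePotential_eq_neg_mul_phi hq _

/-! ## Tails of blocks of a separated periodic configuration -/

/-- Punctured inverse-power sums over an `m`-separated periodic configuration are uniformly
bounded: `Σ'_{y ≠ x} |x − y|⁻ᵠ ≤ 1024/(m³ m^{q−3})` at every point `x` of the configuration
(`q ≥ 4`). [folklore] -/
theorem tsum_inv_pow_le_of_sep (Q : PeriodicConfiguration 3) {m : ℝ} (hm : 0 < m)
    (hsep : ∀ x ∈ Q.points, ∀ y ∈ Q.points, x ≠ y → m ≤ dist x y) {q : ℕ} (hq : 4 ≤ q)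
    {x : EuclideanSpace ℝ (Fin 3)} (hx : x ∈ Q.points) :
    ∑' y : {y // y ∈ Q.points ∧ y ≠ x}, (dist x y.1)⁻¹ ^ q ≤ 1024 / (m ^ 3 * m ^ (q - 3)) := by
  obtain ⟨k, rfl⟩ : ∃ k, q = k + 3 := ⟨q - 3, by omega⟩
  have hk : 1 ≤ k := by omega
  rw [Nat.add_sub_cancel]
  have hfar : ∀ y : {y // y ∈ Q.points ∧ y ≠ x}, m ≤ dist y.1 x := fun y =>
    hsep y.1 y.2.1 x hx y.2.2
  refine le_trans ?_ (tsum_inv_pow_le_of_separated x hk hm le_rfl hsep)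
  refine Summable.tsum_le_tsum_of_inj
    (fun y : {y // y ∈ Q.points ∧ y ≠ x} =>
      (⟨y.1, y.2.1, hfar y⟩ : {a' // a' ∈ Q.points ∧ m ≤ dist a' x}))
    (fun y y' hyy' => Subtype.ext (by simpa using congrArg Subtype.val hyy'))
    (fun c _ => by positivity) (fun y => by rw [dist_comm]) ?_ ?_
  · exact Q.summable_inv_pow_dist (n := k + 3) (by omega) x
  · exact summable_inv_pow_of_separated x hk hm le_rfl hsep

/-- The inverse-power sum outside a block, at any block point of an `m`-separated periodic
configuration, is `≤ 1024/(m³ m^{q−3})`. [folklore] -/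
theorem tsum_compl_inv_pow_le_of_sep (Q : PeriodicConfiguration 3) {m : ℝ} (hm : 0 < m)
    (hsep : ∀ x ∈ Q.points, ∀ y ∈ Q.points, x ≠ y → m ≤ dist x y) {q : ℕ} (hq : 4 ≤ q)
    (K : ℕ) (u : BIdx Q K) :
    ∑' y : ((blockOthers Q K u : Set {y // y ∈ Q.points ∧ y ≠ bpt Q K u})ᶜ : Set _),
        (dist (bpt Q K u) y.1.1)⁻¹ ^ q ≤ 1024 / (m ^ 3 * m ^ (q - 3)) := by
  refine le_trans ?_ (tsum_inv_pow_le_of_sep Q hm hsep hq (bpt_mem Q K u))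
  exact (Q.summable_inv_pow_dist (n := q) (by omega) (bpt Q K u)).tsum_subtype_le
    (fun y : {y // y ∈ Q.points ∧ y ≠ bpt Q K u} => (dist (bpt Q K u) y.1)⁻¹ ^ q) _
    (fun _ => by positivity)

/-- At a `depth Q R`-deep block point of an `m`-separated periodic configuration the
inverse-power sum outside the block is `≤ 1024/(m³ R^{q−3})` (`R ≥ m`; `Blocks.le_dist_of_deep`).
[folklore] -/
theorem tsum_compl_inv_pow_le_of_deep (Q : PeriodicConfiguration 3) {m : ℝ} (hm : 0 < m)
    (hsep : ∀ x ∈ Q.points, ∀ y ∈ Q.points, x ≠ y → m ≤ dist x y) {q : ℕ} (hq : 4 ≤ q)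
    {R : ℝ} (hR : m ≤ R) (K : ℕ) (u : BIdx Q K) (hdeep : IsDeep K (depth Q R) u.2) :
    ∑' y : ((blockOthers Q K u : Set {y // y ∈ Q.points ∧ y ≠ bpt Q K u})ᶜ : Set _),
        (dist (bpt Q K u) y.1.1)⁻¹ ^ q ≤ 1024 / (m ^ 3 * R ^ (q - 3)) := by
  obtain ⟨k, rfl⟩ : ∃ k, q = k + 3 := ⟨q - 3, by omega⟩
  have hk : 1 ≤ k := by omega
  rw [Nat.add_sub_cancel]
  have hfar : ∀ y : ((blockOthers Q K u : Set {y // y ∈ Q.points ∧ y ≠ bpt Q K u})ᶜ : Set _),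
      R ≤ dist y.1.1 (bpt Q K u) := fun y => by
    rw [dist_comm]
    exact le_dist_of_deep Q K hdeep y.1 fun hmem =>
      (Set.mem_compl_iff _ _).1 y.2 (Finset.mem_coe.2 hmem)
  refine le_trans ?_ (tsum_inv_pow_le_of_separated (bpt Q K u) hk hm hR hsep)
  refine Summable.tsum_le_tsum_of_inj
    (fun y : ((blockOthers Q K u : Set {y // y ∈ Q.points ∧ y ≠ bpt Q K u})ᶜ : Set _) =>
      (⟨y.1.1, y.1.2.1, hfar y⟩ : {a' // a' ∈ Q.points ∧ R ≤ dist a' (bpt Q K u)}))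
    (fun y y' hyy' => Subtype.ext (Subtype.ext (by simpa using congrArg Subtype.val hyy')))
    (fun c _ => by positivity) (fun y => by rw [dist_comm]) ?_ ?_
  · exact (Q.summable_inv_pow_dist (n := k + 3) (by omega) (bpt Q K u)).subtype _
  · exact summable_inv_pow_of_separated (bpt Q K u) hk hm hR hsep

/-- The Mie tail at a block point is bounded below by `−(1/q)` times the inverse-power sum
outside the block (`V_q ≥ −r⁻ᵠ/q`). [folklore] -/
theorem neg_mul_tsum_le_tail (Q : PeriodicConfiguration 3) {q : ℕ} (hq : 4 ≤ q) (K : ℕ)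
    (u : BIdx Q K) :
    -(1 / (q : ℝ)) * ∑' y : ((blockOthers Q K u : Set {y // y ∈ Q.points ∧ y ≠ bpt Q K u})ᶜ :
        Set _), (dist (bpt Q K u) y.1.1)⁻¹ ^ q ≤ tail Q K (miePotential q) u := by
  unfold tail
  rw [← tsum_mul_left]
  refine Summable.tsum_le_tsum (fun y => neg_mul_inv_pow_le_miePotential (by omega) _) ?_ ?_
  · exact ((Q.summable_inv_pow_dist (n := q) (by omega) (bpt Q K u)).subtype _).mul_left _
  · exact (summable_miePotential_dist Q hq (bpt Q K u)).subtype _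

/-! ## The block energy bound -/

/-- **Energy of an HCP block against the one-centre value.** For `a, h > 0`, `q ≥ 4`,
`R ≥ m = min a h` and the block of `n_K = #F·K³` points of `hcpPeriodicConfiguration`:
`4q·𝓔_{V_q}(block_K) ≤ −n_K·Φ_hcp + 2n_K·1024/(m³R^{q−3}) + 12·#F·depth(R)·K²·1024/(m³m^{q−3})`
(site sums are all `−Φ_hcp/(2q)` by homogeneity; tails are `≥ −(1/q)·(inverse-power sum outside
the block)`, which is small at deep points and bounded at the `≤ 6·depth·K²` non-deep ones).
[folklore] -/
theorem four_q_energy_block_le (ha : 0 < a) (hh : 0 < h) {q : ℕ} (hq : 4 ≤ q) {R : ℝ}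
    (hR : min a h ≤ R) (K : ℕ) :
    4 * (q : ℝ) * interactionEnergy (miePotential q)
        (blockConfig (hcpPeriodicConfiguration ha.ne' hh.ne') K) ≤
      -(Fintype.card (BIdx (hcpPeriodicConfiguration ha.ne' hh.ne') K) : ℝ) *
          (∑' p : ↥(hcpStacking a h), (2 * (‖(p : EuclideanSpace ℝ (Fin 3))‖)⁻¹ ^ q -
            (‖(p : EuclideanSpace ℝ (Fin 3))‖)⁻¹ ^ (2 * q))) +
        2 * (Fintype.card (BIdx (hcpPeriodicConfiguration ha.ne' hh.ne') K) : ℝ) *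
          (1024 / ((min a h) ^ 3 * R ^ (q - 3))) +
        12 * ((hcpPeriodicConfiguration ha.ne' hh.ne').motif.card : ℝ) *
          (depth (hcpPeriodicConfiguration ha.ne' hh.ne') R) * (K : ℝ) ^ 2 *
          (1024 / ((min a h) ^ 3 * (min a h) ^ (q - 3))) := by
  classical
  have hq0 : q ≠ 0 := by omega
  have hqpos : (0 : ℝ) < q := Nat.cast_pos.2 (by omega)
  set Q := hcpPeriodicConfiguration ha.ne' hh.ne' with hQ
  set Φ := ∑' p : ↥(hcpStacking a h), (2 * (‖(p : EuclideanSpace ℝ (Fin 3))‖)⁻¹ ^ q -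
    (‖(p : EuclideanSpace ℝ (Fin 3))‖)⁻¹ ^ (2 * q)) with hΦ
  set τ := 1024 / ((min a h) ^ 3 * R ^ (q - 3)) with hτ
  set C₀ := 1024 / ((min a h) ^ 3 * (min a h) ^ (q - 3)) with hC₀
  set ρ' := depth Q R with hρ'
  set T : BIdx Q K → ℝ := fun u =>
    ∑' y : ((blockOthers Q K u : Set {y // y ∈ Q.points ∧ y ≠ bpt Q K u})ᶜ : Set _),
      (dist (bpt Q K u) y.1.1)⁻¹ ^ q with hT
  have hm : 0 < min a h := lt_min ha hh
  have hsepQ : ∀ x ∈ Q.points, ∀ y ∈ Q.points, x ≠ y → min a h ≤ dist x y :=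
    hcpConfig_separated ha hh
  have hτ0 : 0 ≤ τ := by rw [hτ]; have : 0 < R := hm.trans_le hR; positivity
  have hC₀0 : 0 ≤ C₀ := by rw [hC₀]; positivity
  -- the energy identity with constant site sums
  have h2E := two_mul_energy_block_eq_of_summable Q (miePotential q) (miePotential_zero hq0) K
    (summable_miePotential_dist Q hq)
  have hsite : ∀ u : BIdx Q K, siteSum Q (miePotential q) (bpt Q K u) = -(1 / (2 * (q : ℝ))) * Φ :=
    fun u => hcp_siteSum_miePotential_eq ha.ne' hh.ne' hq0 (bpt_mem Q K u)
  have hsum_site : ∑ u : BIdx Q K, siteSum Q (miePotential q) (bpt Q K u) =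
      (Fintype.card (BIdx Q K) : ℝ) * (-(1 / (2 * (q : ℝ))) * Φ) := by
    rw [Finset.sum_congr rfl fun u _ => hsite u, Finset.sum_const, Finset.card_univ, nsmul_eq_mul]
  -- tails: pointwise lower bound and the count of non-deep points
  have hT_le : ∀ u : BIdx Q K, T u ≤ τ + (if ¬ IsDeep K ρ' u.2 then C₀ else 0) := by
    intro u
    by_cases hd : IsDeep K ρ' u.2
    · rw [if_neg (not_not_intro hd), add_zero]
      exact tsum_compl_inv_pow_le_of_deep Q hm hsepQ hq hR K u hd
    · rw [if_pos hd]
      exact (tsum_compl_inv_pow_le_of_sep Q hm hsepQ hq K u).trans (le_add_of_nonneg_left hτ0)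
  have htail_ge : ∀ u : BIdx Q K, -(1 / (q : ℝ)) * T u ≤ tail Q K (miePotential q) u :=
    fun u => neg_mul_tsum_le_tail Q hq K u
  have hcount : ∑ u : BIdx Q K, (if ¬ IsDeep K ρ' u.2 then C₀ else 0) ≤
      (Q.motif.card : ℝ) * (6 * ρ' * (K : ℝ) ^ 2) * C₀ := by
    rw [Fintype.sum_prod_type]
    have hk : ∀ x : ↥Q.motif, ∑ k : Fin 3 → Fin K, (if ¬ IsDeep K ρ' k then C₀ else 0) ≤
        (6 * ρ' * (K : ℝ) ^ 2) * C₀ := by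
      intro x
      rw [Finset.sum_ite, Finset.sum_const_zero, add_zero, Finset.sum_const, nsmul_eq_mul]
      refine mul_le_mul_of_nonneg_right ?_ hC₀0
      exact_mod_cast card_not_deep_le K ρ'
    calc ∑ x : ↥Q.motif, ∑ k : Fin 3 → Fin K, (if ¬ IsDeep K ρ' k then C₀ else 0)
        ≤ ∑ _x : ↥Q.motif, (6 * ρ' * (K : ℝ) ^ 2) * C₀ := Finset.sum_le_sum fun x _ => hk x
      _ = (Q.motif.card : ℝ) * (6 * ρ' * (K : ℝ) ^ 2) * C₀ := by
          rw [Finset.sum_const, Finset.card_univ, Fintype.card_coe, nsmul_eq_mul]; ring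
  have hsumT : ∑ u : BIdx Q K, T u ≤
      (Fintype.card (BIdx Q K) : ℝ) * τ + (Q.motif.card : ℝ) * (6 * ρ' * (K : ℝ) ^ 2) * C₀ := by
    calc ∑ u : BIdx Q K, T u ≤ ∑ u : BIdx Q K, (τ + (if ¬ IsDeep K ρ' u.2 then C₀ else 0)) :=
          Finset.sum_le_sum fun u _ => hT_le u
      _ = (Fintype.card (BIdx Q K) : ℝ) * τ +
            ∑ u : BIdx Q K, (if ¬ IsDeep K ρ' u.2 then C₀ else 0) := by
          rw [Finset.sum_add_distrib, Finset.sum_const, Finset.card_univ, nsmul_eq_mul]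
      _ ≤ _ := by linarith [hcount]
  have hsum_tail : -(1 / (q : ℝ)) * ((Fintype.card (BIdx Q K) : ℝ) * τ +
      (Q.motif.card : ℝ) * (6 * ρ' * (K : ℝ) ^ 2) * C₀) ≤
        ∑ u : BIdx Q K, tail Q K (miePotential q) u := by
    calc -(1 / (q : ℝ)) * ((Fintype.card (BIdx Q K) : ℝ) * τ +
          (Q.motif.card : ℝ) * (6 * ρ' * (K : ℝ) ^ 2) * C₀)
        ≤ -(1 / (q : ℝ)) * ∑ u : BIdx Q K, T u := by
          have : 0 < 1 / (q : ℝ) := by positivity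
          nlinarith [hsumT]
      _ = ∑ u : BIdx Q K, -(1 / (q : ℝ)) * T u := by rw [Finset.mul_sum]
      _ ≤ ∑ u : BIdx Q K, tail Q K (miePotential q) u := Finset.sum_le_sum fun u _ => htail_ge u
  -- combine: `2E = Σ site − Σ tail`
  rw [hsum_site] at h2E
  have key : 2 * interactionEnergy (miePotential q) (blockConfig Q K) ≤
      (Fintype.card (BIdx Q K) : ℝ) * (-(1 / (2 * (q : ℝ))) * Φ) +
        (1 / (q : ℝ)) * ((Fintype.card (BIdx Q K) : ℝ) * τ +
          (Q.motif.card : ℝ) * (6 * ρ' * (K : ℝ) ^ 2) * C₀) := by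
    linarith
  have key' := mul_le_mul_of_nonneg_left key (le_of_lt (mul_pos two_pos hqpos))
  have hq' : (q : ℝ) ≠ 0 := hqpos.ne'
  calc 4 * (q : ℝ) * interactionEnergy (miePotential q) (blockConfig Q K)
      = 2 * (q : ℝ) * (2 * interactionEnergy (miePotential q) (blockConfig Q K)) := by ring
    _ ≤ 2 * (q : ℝ) * ((Fintype.card (BIdx Q K) : ℝ) * (-(1 / (2 * (q : ℝ))) * Φ) +
        (1 / (q : ℝ)) * ((Fintype.card (BIdx Q K) : ℝ) * τ +
          (Q.motif.card : ℝ) * (6 * ρ' * (K : ℝ) ^ 2) * C₀)) := key'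
    _ = -(Fintype.card (BIdx Q K) : ℝ) * Φ + 2 * (Fintype.card (BIdx Q K) : ℝ) * τ +
        12 * (Q.motif.card : ℝ) * ρ' * (K : ℝ) ^ 2 * C₀ := by
        field_simp
        ring

end Hcp

end Summit.AtomisticToContinuum.Crystallization.Theorems.OneCentreSteepnessLadderZeroDensity

end
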